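import Summits.CriticalPhenomena.SAWScalingLimit.Theorems.SAWDefectDecoherenceBoundaryClosureRBoundaryExactnessZigzag
import Summits.CriticalPhenomena.SAWScalingLimit.Theorems.SAWDefectDecoherenceBoundaryClosureRBoundaryExactnessPhase
import Summits.CriticalPhenomena.SAWScalingLimit.Theorems.SAWDefectDecoherencePickHalfPlaneDefs
import Mathlib.Data.Int.Range
import HarnessLib

/-!
# Boundary bookkeeping for the developing map along a trail of boundary darts

Route `SAWDefectDecoherence`, crux `BoundaryClosureR` (stmt-CriticalPhenomena-14004), line
`pick-half-plane`, serving `stub_halfPlaneInputs` (boundary half, root frame): the registered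
sub-goal `stub_halfPlaneInputs_boundaryBookkeepingPath`.
For a simply connected `Λ` with a flat floor `k₁ ≤ k ≤ k₂` of row `m`, the root `a = floorEdge ka m`
ON the floor and a potential `H` of `F dz`, `Re H` is controlled along any TRAIL of boundary darts
(consecutive steps across the `𝕋`-edges dual to pairwise distinct boundary darts, floor darts other
than the root crossed TOWARDS the root): `Re H(end) − Re H(start) ≤ ‖(c_up − c_below)/2‖ · Σ_{darts
off the floor} Z`, `Z = ‖F_{x_c,0}‖`.  Per step (`step_re_le`): off the floor
`|ΔH| = |mid_e − c_v|·|F_{5/8}(e)| ≤ (1/(2√3))·Z(e)`; across the root `ΔH = ∓ i/(2√3)` (`F(a) = 1`),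
`Re` unchanged; across `floorEdge k m`, `k ≠ ka`, eastwards `ΔH = (i/(2√3))·e^{i(3/8)W_e}·Z(e)`
(phase law (E2)) with the rigid winding `W_e = −π` east of the root, `+π` west of it (explicit
floor walks + rigidity): `Re H` DECREASES INTO THE ROOT from both sides.  NOT here: the existence
of such a trail from the normaliser to every boundary site (the boundary contour of a hex domain
without floor pinches) — the remaining input for the per-domain bookkeeping [A] of the line.
-/

noncomputable section

open Literature.Probability.LatticeModels Literature.Probability.RandomPlanarGeometry.SAW
open Literature.Barriers.CriticalPhenomena.HexGreen (nbrs mem_nbrs_iff)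
open Summit.CriticalPhenomena.SAWScalingLimit.Theorems.SpinShift (norm_hexCenter_sub_eq_of_adj)

namespace Summit.CriticalPhenomena.SAWScalingLimit.Theorems.PickHalfPlane.BoundaryExactness

variable {Λ : Finset HexVertex}

/-- Reversing the edge `p → q` reverses the orientation of a point `c` with respect to it.
[folklore] -/
theorem orient_swap (p q : Site 2) (c : ℂ) :
    ((starRingEnd ℂ) (triEmbed p - triEmbed q) * (c - triEmbed q)).im =
      -((starRingEnd ℂ) (triEmbed q - triEmbed p) * (c - triEmbed p)).im := by
  have h : (starRingEnd ℂ) (triEmbed p - triEmbed q) * (c - triEmbed q) =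
      -((starRingEnd ℂ) (triEmbed q - triEmbed p) * (c - triEmbed p)) +
        (Complex.normSq (triEmbed q - triEmbed p) : ℂ) := by
    rw [Complex.normSq_eq_conj_mul_self]; simp only [map_sub]; ring
  rw [h, Complex.add_im, Complex.neg_im, Complex.ofReal_im, add_zero]

/-- The centre of a face lies strictly on one side of each of its edges. [folklore] -/
theorem orient_ne_zero {v : HexVertex} {p q : Site 2} (hp : p ∈ hexFaceVertices v)
    (hq : q ∈ hexFaceVertices v) (hpq : p ≠ q) :
    ((starRingEnd ℂ) (triEmbed q - triEmbed p) * (hexCenter v - triEmbed p)).im ≠ 0 := by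
  have h3 : (0 : ℝ) < Real.sqrt 3 := Real.sqrt_pos.2 (by norm_num)
  have hsq : Real.sqrt 3 * Real.sqrt 3 = 3 := Real.mul_self_sqrt (by norm_num)
  obtain ⟨x, i⟩ := v
  fin_cases i <;>
    simp only [Fin.zero_eta, Fin.mk_one, Fin.isValue, mem_hexFaceVertices_zero,
      mem_hexFaceVertices_one] at hp hq ⊢ <;>
    rcases hp with rfl | rfl | rfl <;> rcases hq with rfl | rfl | rfl <;>
      first
      | exact absurd rfl hpq
      | (simp [hexCenter, triEmbed_add, Complex.mul_im, triZeta_re, triZeta_im]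
         try nlinarith)

/-- **The increment of a potential across a lattice edge `p q` of the face `v ∈ Λ` dual to the
hexagonal edge `{v, t}`** is `± (mid{v,t} − c_v)·F({v,t})`, the sign being the orientation.
[folklore] -/
theorem potential_step {a : Sym2 HexVertex} {H : Site 2 → ℂ} (hH : IsPotential Λ a H)
    {v t : HexVertex} (hv : v ∈ Λ) (hvt : hexGraph.Adj v t) {p q : Site 2}
    (hpv : p ∈ hexFaceVertices v) (hpt : p ∈ hexFaceVertices t) (hqv : q ∈ hexFaceVertices v)
    (hqt : q ∈ hexFaceVertices t) (hpq : p ≠ q) :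
    H q - H p = (hexMidpoint s(v, t) - hexCenter v) *
        hexParafermionicObservable Λ a hexCriticalFugacity (5 / 8) s(v, t) ∨
      H q - H p = -((hexMidpoint s(v, t) - hexCenter v) *
        hexParafermionicObservable Λ a hexCriticalFugacity (5 / 8) s(v, t)) := by
  rcases lt_trichotomy 0
      ((starRingEnd ℂ) (triEmbed q - triEmbed p) * (hexCenter v - triEmbed p)).im with h | h | h
  · exact Or.inl (hH v hv t hvt p q hpv hqv hpt hqt hpq h)
  · exact absurd h.symm (orient_ne_zero hpv hqv hpq)
  · right
    have h' : 0 < ((starRingEnd ℂ) (triEmbed p - triEmbed q) * (hexCenter v - triEmbed q)).im := by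
      rw [orient_swap]; linarith
    linear_combination (-1 : ℂ) * hH v hv t hvt q p hqv hpv hqt hpt hpq.symm h'

/-- **Crude step bound**: `|(mid{v,t} − c_v)·F_{x_c,5/8}({v,t})| ≤ ‖(c_w − c_u)/2‖ · Z({v,t})` for
any edge `{u, w}` of `ℍ` (all edges have the same length) and the arrival mass
`Z = ‖F_{x_c,0}‖ = Σ x_c^ℓ ≥ |F_{x_c,σ}|`. [folklore] -/
theorem norm_step_le {a : Sym2 HexVertex} {v t u w : HexVertex} (hvt : hexGraph.Adj v t)
    (huw : hexGraph.Adj u w) :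
    ‖(hexMidpoint s(v, t) - hexCenter v) *
        hexParafermionicObservable Λ a hexCriticalFugacity (5 / 8) s(v, t)‖ ≤
      ‖(hexCenter w - hexCenter u) / 2‖ *
        ‖hexParafermionicObservable Λ a hexCriticalFugacity 0 s(v, t)‖ := by
  have h0 : (0 : ℝ) ≤ hexCriticalFugacity := hexCriticalFugacity_pos_lt_one.1.le
  have hmid : hexMidpoint s(v, t) - hexCenter v = (hexCenter t - hexCenter v) / 2 := by
    rw [hexMidpoint_mk]; ring
  have hlen : ‖(hexCenter t - hexCenter v) / 2‖ = ‖(hexCenter w - hexCenter u) / 2‖ := by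
    rw [norm_div, norm_div, norm_hexCenter_sub_eq_of_adj hvt huw]
  have hZ : ‖hexParafermionicObservable Λ a hexCriticalFugacity 0 s(v, t)‖ =
      ∑ γ : HexMidEdgeSAW Λ a s(v, t), hexCriticalFugacity ^ γ.length := by
    rw [hexParafermionicObservable_zero_spin, Complex.norm_real,
      Real.norm_of_nonneg (Finset.sum_nonneg fun γ _ => pow_nonneg h0 _)]
  rw [norm_mul, hmid, hlen, hZ]
  exact mul_le_mul_of_nonneg_left (norm_hexParafermionicObservable_le Λ a h0 _ _) (norm_nonneg _)

/-- The dressed floor direction `(c_up − c_below)/2 = ((2ζ − 1)/3)/2 = (√3/6)·i`. [folklore] -/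
theorem floorDir_eq : (2 * triZeta - 1) / 3 / 2 = ((Real.sqrt 3 / 6 : ℝ) : ℂ) * Complex.I := by
  apply Complex.ext <;> simp [triZeta_re, triZeta_im]; ring

/-- The real part of the dressed floor direction: `Re(((2ζ − 1)/3)/2 · e^{i(3/8)W}) =
−(√3/6)·sin((3/8)W)` (`(2ζ − 1)/3 = i/√3`). [folklore] -/
theorem re_floorDir_mul_exp (W : ℝ) :
    ((2 * triZeta - 1) / 3 / 2 * Complex.exp (Complex.I * (3 / 8 : ℂ) * (W : ℂ))).re =
      -(Real.sqrt 3 / 6) * Real.sin (3 / 8 * W) := by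
  have harg : Complex.I * (3 / 8 : ℂ) * (W : ℂ) = ((3 / 8 * W : ℝ) : ℂ) * Complex.I := by
    push_cast; ring
  rw [harg, Complex.exp_mul_I, ← Complex.ofReal_cos, ← Complex.ofReal_sin, floorDir_eq]
  simp only [Complex.mul_re, Complex.mul_im, Complex.add_re, Complex.add_im, Complex.ofReal_re,
    Complex.ofReal_im, Complex.I_re, Complex.I_im]
  ring

/-- The vertical vector of a floor dart: `c(upFace k m) − c(belowFace k m) = (2ζ − 1)/3 = i/√3`.
[folklore] -/
theorem hexCenter_upFace_sub_belowFace (k m : ℤ) :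
    hexCenter (upFace k m) - hexCenter (belowFace k m) = (2 * triZeta - 1) / 3 := by
  have h := hexMidpoint_floorEdge_sub k m
  unfold floorEdge at h
  rw [hexMidpoint_mk] at h
  linear_combination (-2 : ℂ) * h

/-- One EASTWARD step of a potential along the floor sites `(k, m) → (k+1, m)` is the half-edge
increment `(mid − c_up)·F(floorEdge k m)` (the centre of `upFace k m` lies to the left).
[folklore] -/
theorem potential_floor_step {a : Sym2 HexVertex} {H : Site 2 → ℂ} (hH : IsPotential Λ a H)
    {k m : ℤ} (hup : upFace k m ∈ Λ) :
    H ![k + 1, m] - H ![k, m] = (hexMidpoint (floorEdge k m) - hexCenter (upFace k m)) *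
      hexParafermionicObservable Λ a hexCriticalFugacity (5 / 8) (floorEdge k m) := by
  have h1 : (![k + 1, m] : Site 2) = ![k, m] + Pi.single 0 1 := by ext i; fin_cases i <;> simp
  have hsv : (![k, m] : Site 2) ∈ hexFaceVertices (upFace k m) := by
    unfold upFace; rw [mem_hexFaceVertices_zero]; exact Or.inl rfl
  have htv : (![k + 1, m] : Site 2) ∈ hexFaceVertices (upFace k m) := by
    unfold upFace; rw [mem_hexFaceVertices_zero, h1]; exact Or.inr (Or.inl rfl)
  have hsw : (![k, m] : Site 2) ∈ hexFaceVertices (belowFace k m) := by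
    unfold belowFace; rw [mem_hexFaceVertices_one]
    exact Or.inr (Or.inl (by ext i; fin_cases i <;> simp))
  have htw : (![k + 1, m] : Site 2) ∈ hexFaceVertices (belowFace k m) := by
    unfold belowFace; rw [mem_hexFaceVertices_one]
    exact Or.inr (Or.inr (by ext i; fin_cases i <;> simp))
  have hne : (![k, m] : Site 2) ≠ ![k + 1, m] := fun h => by simpa using congrFun h 0
  have hor : 0 < ((starRingEnd ℂ) (triEmbed ![k + 1, m] - triEmbed ![k, m]) *
      (hexCenter (upFace k m) - triEmbed ![k, m])).im := by
    rw [h1, triEmbed_add, triEmbed_single_zero]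
    unfold upFace
    simp only [hexCenter, add_sub_cancel_left, Fin.val_zero, Nat.cast_zero, zero_add, one_mul,
      map_one]
    simp [triZeta_im]
  have key := hH (upFace k m) hup (belowFace k m) (adj_belowFace_upFace k m).symm ![k, m] ![k + 1, m]
    hsv htv hsw htw hne hor
  rw [key]
  unfold floorEdge
  rw [Sym2.eq_swap]

/-- **The sign of a floor step** (root `floorEdge ka m` ON the flat floor): the eastward step of
`Re H` across the dual of `floorEdge k m` is `+(√3/6)·sin(3π/8)·Z` east of the root (`ka < k`, rigid
winding `−π`) and `−(√3/6)·sin(3π/8)·Z` west of it (`k < ka`, winding `+π`). [folklore] -/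
theorem re_floor_step (hΛ : hexDomainSimplyConnected Λ) {m k₁ k₂ ka : ℤ}
    (hF : ∀ k : ℤ, k₁ ≤ k → k ≤ k₂ → ((![k, m], 0) : HexVertex) ∈ Λ ∧
      ((![k, m - 1], 1) : HexVertex) ∉ Λ ∧ (k < k₂ → ((![k, m], 1) : HexVertex) ∈ Λ))
    (hka₁ : k₁ ≤ ka) (hka₂ : ka ≤ k₂) {H : Site 2 → ℂ} (hH : IsPotential Λ (floorEdge ka m) H)
    {k : ℤ} (hk₁ : k₁ ≤ k) (hk₂ : k ≤ k₂) :
    (ka < k → (H ![k + 1, m] - H ![k, m]).re = Real.sqrt 3 / 6 * Real.sin (3 / 8 * Real.pi) *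
        ‖hexParafermionicObservable Λ (floorEdge ka m) hexCriticalFugacity 0 (floorEdge k m)‖) ∧
    (k < ka → (H ![k + 1, m] - H ![k, m]).re = -(Real.sqrt 3 / 6 * Real.sin (3 / 8 * Real.pi)) *
        ‖hexParafermionicObservable Λ (floorEdge ka m) hexCriticalFugacity 0 (floorEdge k m)‖) := by
  have hua := adj_belowFace_upFace ka m
  have ha := mk_mem_hexDomainBoundary hua (hF ka hka₁ hka₂).2.1 (hF ka hka₁ hka₂).1
  have hb := mk_mem_hexDomainBoundary (adj_belowFace_upFace k m) (hF k hk₁ hk₂).2.1 (hF k hk₁ hk₂).1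
  rw [potential_floor_step hH (hF k hk₁ hk₂).1]
  set Z : ℝ := ‖hexParafermionicObservable Λ (floorEdge ka m) hexCriticalFugacity 0 (floorEdge k m)‖
    with hZ
  -- the phase law at `floorEdge k m` along a walk `γ` from the root
  have main : ∀ (hkne : k ≠ ka) (γ : HexMidEdgeSAW Λ (floorEdge ka m) (floorEdge k m)),
      ((hexMidpoint (floorEdge k m) - hexCenter (upFace k m)) *
        hexParafermionicObservable Λ (floorEdge ka m) hexCriticalFugacity (5 / 8) (floorEdge k m)).re =
      -(Real.sqrt 3 / 6) * Real.sin (3 / 8 * γ.winding) * Z := by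
    intro hkne γ
    have hne : floorEdge k m ≠ floorEdge ka m := floorEdge_ne (m := m) hkne
    have hE2 := boundaryExactness_phaseLaw Λ hΛ (belowFace ka m) (upFace ka m) hua
      (hF ka hka₁ hka₂).2.1 (hF ka hka₁ hka₂).1 (belowFace k m) (upFace k m)
      (adj_belowFace_upFace k m) (hF k hk₁ hk₂).2.1 (hF k hk₁ hk₂).1 hne γ
    change (hexMidpoint (floorEdge k m) - hexCenter (upFace k m)) *
      hexParafermionicObservable Λ (floorEdge ka m) hexCriticalFugacity (5 / 8) (floorEdge k m) = _
      at hE2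
    rw [hE2, hexCenter_upFace_sub_belowFace, Complex.mul_re, Complex.ofReal_re, Complex.ofReal_im,
      mul_zero, sub_zero, re_floorDir_mul_exp]
    rfl
  -- without walks both sides vanish
  by_cases hne : Nonempty (HexMidEdgeSAW Λ (floorEdge ka m) (floorEdge k m))
  swap
  · rw [not_nonempty_iff] at hne
    have h0 : ((hexMidpoint (floorEdge k m) - hexCenter (upFace k m)) * hexParafermionicObservable
        Λ (floorEdge ka m) hexCriticalFugacity (5 / 8) (floorEdge k m)).re = 0 ∧ Z = 0 := by
      simp [hZ, hexParafermionicObservable]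
    rw [h0.1, h0.2]; simp
  obtain ⟨γ⟩ := hne
  have hw := fun W : HexMidEdgeSAW Λ (floorEdge ka m) (floorEdge k m) =>
    boundaryWindingRigidity_proof Λ hΛ _ ha _ hb γ W
  constructor
  · intro hlt
    obtain ⟨⟨W, hW⟩, -⟩ := exists_floor_walks hF hka₁ hk₂ hlt
    have hw' : γ.winding = -Real.pi := (hw W).trans hW
    rw [main hlt.ne' γ, hw', mul_neg, Real.sin_neg]
    ring
  · intro hgt
    obtain ⟨-, W, hW⟩ := exists_floor_walks hF hk₁ hka₂ hgt
    have hw' : γ.winding = Real.pi := (hw W).trans hW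
    rw [main hgt.ne γ, hw']
    ring

/-- **Crossing the root changes `Re H` by nothing**: `(mid_a − c_up)·F(a) = (mid_a − c_up)` is
purely imaginary (`F(a) = 1` at the boundary root `a`). [folklore] -/
theorem re_root_step {ka m : ℤ} (hB : belowFace ka m ∉ Λ) (hU : upFace ka m ∈ Λ) :
    ((hexMidpoint s(upFace ka m, belowFace ka m) - hexCenter (upFace ka m)) *
      hexParafermionicObservable Λ (floorEdge ka m) hexCriticalFugacity (5 / 8)
        s(upFace ka m, belowFace ka m)).re = 0 := by
  have ha : floorEdge ka m ∈ hexDomainBoundary Λ :=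
    mk_mem_hexDomainBoundary (adj_belowFace_upFace ka m) hB hU
  rw [Sym2.eq_swap]
  change ((hexMidpoint (floorEdge ka m) - hexCenter (upFace ka m)) *
    hexParafermionicObservable Λ (floorEdge ka m) hexCriticalFugacity (5 / 8) (floorEdge ka m)).re = 0
  rw [hexParafermionicObservable_self ha, mul_one]
  exact re_hexMidpoint_floorEdge_sub ka m

/-- **The bookkeeping of one step** from the site `p` to the site `q ≠ p` across the `𝕋`-edge dual
to the boundary dart `(v, t)` (`v ∈ Λ ∌ t`), floor darts other than the root crossed TOWARDS the
root: `Re H(q) − Re H(p) ≤ ‖(c_up − c_below)/2‖ · Z({v,t})` off the floor, `≤ 0` on it. [folklore] -/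
theorem step_re_le (hΛ : hexDomainSimplyConnected Λ) {m k₁ k₂ ka : ℤ}
    (hF : ∀ k : ℤ, k₁ ≤ k → k ≤ k₂ → ((![k, m], 0) : HexVertex) ∈ Λ ∧
      ((![k, m - 1], 1) : HexVertex) ∉ Λ ∧ (k < k₂ → ((![k, m], 1) : HexVertex) ∈ Λ))
    (hka₁ : k₁ ≤ ka) (hka₂ : ka ≤ k₂) {H : Site 2 → ℂ}
    (hH : IsPotential Λ s(((![ka, m - 1], 1) : HexVertex), ((![ka, m], 0) : HexVertex)) H)
    {p q : Site 2} {v t : HexVertex} (hv : v ∈ Λ) (ht : t ∉ Λ) (hvt : hexGraph.Adj v t)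
    (hpq : p ≠ q) (hpv : p ∈ hexFaceVertices v) (hpt : p ∈ hexFaceVertices t)
    (hqv : q ∈ hexFaceVertices v) (hqt : q ∈ hexFaceVertices t)
    (hside : ∀ k : ℤ, k₁ ≤ k → k ≤ k₂ →
      s(t, v) = s(((![k, m - 1], 1) : HexVertex), ((![k, m], 0) : HexVertex)) →
      (ka < k → p = ![k + 1, m] ∧ q = ![k, m]) ∧ (k < ka → p = ![k, m] ∧ q = ![k + 1, m])) :
    (H q).re - (H p).re ≤
      ‖(hexCenter ((![ka, m], 0) : HexVertex) - hexCenter ((![ka, m - 1], 1) : HexVertex)) / 2‖ *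
        (if s(t, v) ≠ s(((![ka, m - 1], 1) : HexVertex), ((![ka, m], 0) : HexVertex)) ∧
            ∀ k : ℤ, k₁ ≤ k → k ≤ k₂ →
              s(t, v) ≠ s(((![k, m - 1], 1) : HexVertex), ((![k, m], 0) : HexVertex))
          then ‖hexParafermionicObservable Λ
            s(((![ka, m - 1], 1) : HexVertex), ((![ka, m], 0) : HexVertex)) hexCriticalFugacity 0
              s(t, v)‖ else 0) := by
  have hs3 : 0 < Real.sqrt 3 / 6 * Real.sin (3 / 8 * Real.pi) := mul_pos (by positivity)
    (Real.sin_pos_of_pos_of_lt_pi (by positivity) (by nlinarith [Real.pi_pos]))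
  by_cases hseg : ∃ k : ℤ, k₁ ≤ k ∧ k ≤ k₂ ∧
      s(t, v) = s(((![k, m - 1], 1) : HexVertex), ((![k, m], 0) : HexVertex))
  · -- a floor dart: no cost
    obtain ⟨k, hk₁, hk₂, hk⟩ := hseg
    rw [if_neg (fun h => h.2 k hk₁ hk₂ hk), mul_zero]
    have hvt' : t = (![k, m - 1], 1) ∧ v = (![k, m], 0) := by
      rcases Sym2.eq_iff.1 hk with ⟨h1, h2⟩ | ⟨h1, h2⟩
      · exact ⟨h1, h2⟩
      · exact absurd (h2 ▸ hv) (hF k hk₁ hk₂).2.1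
    obtain ⟨rfl, rfl⟩ := hvt'
    have hZ0 : 0 ≤ ‖hexParafermionicObservable Λ (floorEdge ka m) hexCriticalFugacity 0
        (floorEdge k m)‖ := norm_nonneg _
    rcases lt_trichotomy ka k with hlt | rfl | hgt
    · obtain ⟨rfl, rfl⟩ := (hside k hk₁ hk₂ hk).1 hlt
      have h := (re_floor_step hΛ hF hka₁ hka₂ hH hk₁ hk₂).1 hlt
      rw [Complex.sub_re] at h
      nlinarith
    · -- the root itself
      rcases potential_step hH hv hvt hpv hpt hqv hqt hpq with h | h <;>
      · rw [← Complex.sub_re, h]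
        have h0 := re_root_step (Λ := Λ) (hF ka hka₁ hka₂).2.1 (hF ka hka₁ hka₂).1
        simp only [floorEdge, upFace, belowFace, Complex.neg_re] at h0 ⊢
        linarith
    · obtain ⟨rfl, rfl⟩ := (hside k hk₁ hk₂ hk).2 hgt
      have h := (re_floor_step hΛ hF hka₁ hka₂ hH hk₁ hk₂).2 hgt
      rw [Complex.sub_re] at h
      nlinarith
  · -- a dart off the floor: the crude bound
    rw [if_pos ⟨fun h => hseg ⟨ka, hka₁, hka₂, h⟩, fun k hk₁ hk₂ h => hseg ⟨k, hk₁, hk₂, h⟩⟩]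
    calc (H q).re - (H p).re = (H q - H p).re := (Complex.sub_re _ _).symm
      _ ≤ ‖H q - H p‖ := Complex.re_le_norm _
      _ = ‖(hexMidpoint s(v, t) - hexCenter v) *
            hexParafermionicObservable Λ s(((![ka, m - 1], 1) : HexVertex), ((![ka, m], 0) :
              HexVertex)) hexCriticalFugacity (5 / 8) s(v, t)‖ := by
          rcases potential_step hH hv hvt hpv hpt hqv hqt hpq with h | h
          · rw [h]
          · rw [h, norm_neg]
      _ ≤ _ := by
          rw [Sym2.eq_swap (a := t)]
          exact norm_step_le hvt (adj_belowFace_upFace ka m)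

/-- **Telescoping along a trail**: if consecutive steps `(p, q)` share `q = p'` and each step costs
at most `c`, the total change of `f` from the first `p` to the last `q` is at most the total cost.
[folklore] -/
theorem trail_telescope {α : Type*} (f : Site 2 → ℝ) (c : α → ℝ) :
    ∀ (T : List ((Site 2 × Site 2) × α)) (hT : T ≠ []),
      T.IsChain (fun st st' => st.1.2 = st'.1.1) → (∀ st ∈ T, f st.1.2 - f st.1.1 ≤ c st.2) →
      f (T.getLast hT).1.2 - f (T.head hT).1.1 ≤ (T.map fun st => c st.2).sum
  | [], hT, _, _ => absurd rfl hT
  | [st], _, _, h => by simpa using h st (by simp)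
  | st :: st' :: rest, _, hc, h => by
    have ih := trail_telescope f c (st' :: rest) (List.cons_ne_nil _ _)
      (List.isChain_cons_cons.1 hc).2 fun x hx => h x (List.mem_cons_of_mem _ hx)
    have h1 := h st (by simp)
    rw [(List.isChain_cons_cons.1 hc).1] at h1
    simp only [List.map_cons, List.sum_cons, List.getLast_cons_cons, List.head_cons] at ih ⊢
    linarith

/-- **Each dart at most once**: a nonnegative weight summed over a duplicate-free list of boundary
darts `(v, t)` (`v ∈ Λ`, `t ∉ Λ`, `v ∼ t`) is at most its sum over all boundary darts. [folklore] -/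
theorem trail_sum_le (g : HexVertex → HexVertex → ℝ) (hg : ∀ v t, 0 ≤ g v t)
    (D : List (HexVertex × HexVertex)) (hD : D.Nodup)
    (hval : ∀ d ∈ D, d.1 ∈ Λ ∧ d.2 ∉ Λ ∧ hexGraph.Adj d.1 d.2) :
    (D.map fun d => g d.1 d.2).sum ≤ ∑ v ∈ Λ, ∑ t ∈ (nbrs v).filter (· ∉ Λ), g v t := by
  classical
  set e : HexVertex × HexVertex ↪ (Σ _ : HexVertex, HexVertex) :=
    (Equiv.sigmaEquivProd HexVertex HexVertex).symm.toEmbedding with he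
  have h1 : (D.map fun d => g d.1 d.2).sum = ∑ x ∈ D.toFinset.map e, g x.1 x.2 := by
    rw [Finset.sum_map, ← List.sum_toFinset _ hD]
    rfl
  have h2 : ∑ v ∈ Λ, ∑ t ∈ (nbrs v).filter (· ∉ Λ), g v t =
      ∑ x ∈ Λ.sigma (fun v => (nbrs v).filter (· ∉ Λ)), g x.1 x.2 :=
    (Finset.sum_sigma Λ (fun v => (nbrs v).filter (· ∉ Λ)) fun x => g x.1 x.2).symm
  rw [h1, h2]
  refine Finset.sum_le_sum_of_subset_of_nonneg (fun x hx => ?_) fun x _ _ => hg _ _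
  obtain ⟨d, hd, rfl⟩ := Finset.mem_map.1 hx
  obtain ⟨hv, ht, hadj⟩ := hval d (List.mem_toFinset.1 hd)
  rw [Finset.mem_sigma, Finset.mem_filter, mem_nbrs_iff]
  exact ⟨hv, hadj, ht⟩

/-- **Registered sub-goal `stub_halfPlaneInputs_boundaryBookkeepingPath`** of crux
stmt-CriticalPhenomena-14004 (line `pick-half-plane`, serving `stub_halfPlaneInputs`, boundary
half, root frame): the bookkeeping along an ABSTRACT TRAIL.  Flat floor `k₁ ≤ k ≤ k₂` of row `m`
of a simply connected `Λ`, root `{(ka,m-1,1), (ka,m,0)}` ON the floor, `H` a potential of `F dz`;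
`T` a nonempty trail of steps `((p, q), (v, t))`: consecutive (`q = p'`), crossing from the site `p`
to the site `q ≠ p` the `𝕋`-edge dual to the boundary dart `(v, t)` (`v ∈ Λ ∌ t`, `v ∼ t`, `p, q`
vertices of both faces), darts pairwise distinct, floor darts other than the root crossed TOWARDS
the root.  Then `Re H(last q) − Re H(first p) ≤ ‖(c(ka,m,0) − c(ka,m-1,1))/2‖ · Σ Z` over the
boundary darts OFF the floor (`Z = ‖F_{x_c,0}‖`; the constant is `1/(2√3)`).  Remaining for the
per-domain bookkeeping [A]: the CONTOUR (such a trail to every boundary site). [folklore] -/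
theorem stub_halfPlaneInputs_boundaryBookkeepingPath :
    ∀ (Λ : Finset HexVertex), hexDomainSimplyConnected Λ →
    ∀ (m k₁ k₂ ka : ℤ), (∀ k : ℤ, k₁ ≤ k → k ≤ k₂ → ((![k, m], 0) : HexVertex) ∈ Λ ∧
        ((![k, m - 1], 1) : HexVertex) ∉ Λ ∧ (k < k₂ → ((![k, m], 1) : HexVertex) ∈ Λ)) →
      k₁ ≤ ka → ka ≤ k₂ →
    ∀ (H : Site 2 → ℂ),
      IsPotential Λ s(((![ka, m - 1], 1) : HexVertex), ((![ka, m], 0) : HexVertex)) H →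
    ∀ (T : List ((Site 2 × Site 2) × (HexVertex × HexVertex))) (hT : T ≠ []),
      T.IsChain (fun st st' => st.1.2 = st'.1.1) → (T.map Prod.snd).Nodup →
      (∀ st ∈ T, st.2.1 ∈ Λ ∧ st.2.2 ∉ Λ ∧ hexGraph.Adj st.2.1 st.2.2 ∧ st.1.1 ≠ st.1.2 ∧
        st.1.1 ∈ hexFaceVertices st.2.1 ∧ st.1.1 ∈ hexFaceVertices st.2.2 ∧
        st.1.2 ∈ hexFaceVertices st.2.1 ∧ st.1.2 ∈ hexFaceVertices st.2.2 ∧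
        ∀ k : ℤ, k₁ ≤ k → k ≤ k₂ →
          s(st.2.2, st.2.1) = s(((![k, m - 1], 1) : HexVertex), ((![k, m], 0) : HexVertex)) →
          (ka < k → st.1.1 = ![k + 1, m] ∧ st.1.2 = ![k, m]) ∧
          (k < ka → st.1.1 = ![k, m] ∧ st.1.2 = ![k + 1, m])) →
      (H (T.getLast hT).1.2).re - (H (T.head hT).1.1).re ≤
        ‖(hexCenter ((![ka, m], 0) : HexVertex) - hexCenter ((![ka, m - 1], 1) : HexVertex)) / 2‖ *
          ∑ v ∈ Λ, ∑ t ∈ (nbrs v).filter (· ∉ Λ),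
            if s(t, v) ≠ s(((![ka, m - 1], 1) : HexVertex), ((![ka, m], 0) : HexVertex)) ∧
                ∀ k : ℤ, k₁ ≤ k → k ≤ k₂ →
                  s(t, v) ≠ s(((![k, m - 1], 1) : HexVertex), ((![k, m], 0) : HexVertex))
            then ‖hexParafermionicObservable Λ
              s(((![ka, m - 1], 1) : HexVertex), ((![ka, m], 0) : HexVertex)) hexCriticalFugacity 0
                s(t, v)‖ else 0 := by
  intro Λ hΛ m k₁ k₂ ka hF hka₁ hka₂ H hH T hT hchain hnd hval
  set C : ℝ := ‖(hexCenter ((![ka, m], 0) : HexVertex) - hexCenter ((![ka, m - 1], 1) : HexVertex)) / 2‖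
    with hC
  set w : HexVertex → HexVertex → ℝ := fun v t =>
    if s(t, v) ≠ s(((![ka, m - 1], 1) : HexVertex), ((![ka, m], 0) : HexVertex)) ∧
        ∀ k : ℤ, k₁ ≤ k → k ≤ k₂ →
          s(t, v) ≠ s(((![k, m - 1], 1) : HexVertex), ((![k, m], 0) : HexVertex))
      then ‖hexParafermionicObservable Λ
        s(((![ka, m - 1], 1) : HexVertex), ((![ka, m], 0) : HexVertex)) hexCriticalFugacity 0 s(t, v)‖
      else 0 with hw
  have hw0 : ∀ v t, 0 ≤ w v t := fun v t => by
    simp only [hw]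
    exact ite_nonneg (norm_nonneg _) le_rfl
  have hstep : ∀ st ∈ T, (H st.1.2).re - (H st.1.1).re ≤ C * w st.2.1 st.2.2 := by
    intro st hst
    obtain ⟨hv, ht, hvt, hpq, hpv, hpt, hqv, hqt, hside⟩ := hval st hst
    exact step_re_le hΛ hF hka₁ hka₂ hH hv ht hvt hpq hpv hpt hqv hqt hside
  have h1 := trail_telescope (fun x => (H x).re) (fun d => C * w d.1 d.2) T hT hchain hstep
  have h2 := trail_sum_le (Λ := Λ) w hw0 (T.map Prod.snd) hnd fun d hd => by
    obtain ⟨st, hst, rfl⟩ := List.mem_map.1 hd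
    exact ⟨(hval st hst).1, (hval st hst).2.1, (hval st hst).2.2.1⟩
  calc (H (T.getLast hT).1.2).re - (H (T.head hT).1.1).re
      ≤ (T.map fun st => C * w st.2.1 st.2.2).sum := h1
    _ = C * ((T.map Prod.snd).map fun d => w d.1 d.2).sum := by
        rw [List.sum_map_mul_left, List.map_map]; rfl
    _ ≤ C * ∑ v ∈ Λ, ∑ t ∈ (nbrs v).filter (· ∉ Λ), w v t :=
        mul_le_mul_of_nonneg_left h2 (norm_nonneg _)

end Summit.CriticalPhenomena.SAWScalingLimit.Theorems.PickHalfPlane.BoundaryExactness
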